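import Literature.MathematicalPhysics.QuantumFieldTheory.Balaban1983to89.B9Eq3130NeumannLetter

/-!
# `Balaban1983to89.B9Eq3130RightNeumannTransfer` — T. Bałaban, *Propagators for lattice gauge theories in a background field*, Commun. Math. Phys. **99** (1985)
# 389–434 [Balaban1985BackgroundPropagators] (3.130) p. 421 «G = G₀(I − Δ′_πG₀)⁻¹ = Σ_{n≥0} G₀(Δ′_πG₀)ⁿ» — THE RIGHT-GROUPED TRANSFER AS ONE ABSTRACT LETTER FILE:
# **with `K♭ := −Δ′_πG₀ = M∘G′R∘D*G₀ + D R G′∘M†∘(G₀ − D G′R∘D*G₀)` (`M = Δ∘D_U`, `M† = D*_U∘Δ` the ORDER-ZERO current stencils of (3.117), `P = G′RD*`) and the dressing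
# operator `𝔅 = 1 + K♭𝔅`, `G̃ = G₀𝔅`: SEVEN one-sided letters of LANDED type ⟹ (L)(K♭) ⟹ (L)(𝔅) ⟹ (L)(X∘G̃) for EVERY row `X∘G₀` of `G₀` — value, divergence,
# gradient — by ONE composition each; closed-form constants, no hidden existential; the coarse-torus reading in one stroke**

statement-level skeleton of published theorems with citation tags; proofs where landed; nothing here is a claim about the Yang–Mills mass gap

CITATION HEADER (lean-in-tree rule).  Audit cell `pub-balaban`, sub-cell `t4`, BINDER row NE9; filed by the NE9 BINDER-row OWNER lineage `b2b-balaban-t4-ne9-p1`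
(gen 97), ruling R-ne9p1-g97-2 (journal `HOME/CLAIMS.log` l.66097) adopting t4-ne9-idea-1 g155's N55 «RIGHT GROUPING» (l.66063, memo
`t4/ideate/NE9/lens1-g155/N55-RIGHT-NEUMANN-3130-g155.md`) as the primary instantiation road of plan v15 — the sibling of ne9-leaf-05 g88's (K72)
`B9Eq3130TransferPairLetters` (the 2×2 pair grouping).  Source READ first-hand this generation (`paper:balaban1985-cmp99-background-propagators`, journal page =
PDF page + 388): p. 421 (3.130) and the sentence after it («One of the three derivatives there has to be applied either to an expression on the right, or on
the left, of Δ′_π»), p. 419 (3.117)–(3.120), pp. 397–398 Thm 3.1 (3.42)–(3.47), p. 426 Thm 3.13.  COMPOSED BY NAME: ne9-leaf-05's (K61)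
`B9Eq326G1SupRowOfLetters.letter_comp`∕`letter_mono`∕`letter_add` and (K71) `B9Eq3130NeumannLetter.letter_of_neumann'`∕`letter_postcomp_resolvent`; ne9-leaf-03's
`B4Sect5Torus.torusSum_le` (through (K71)'s imports).  Print proves Thm 3.13 by summing (3.130) in the closed system (3.42)–(3.47) with two-sided kernel norms;
the cell's road: the input-side `D*` of `P` lands on `G₀` (its divergence row), the two (3.117) stencils are order zero (`B9Eq3117HessOpGaugeMode`,
`B9Eq3117DivHessOpGaugeMode`, this lineage), so `Δ′_πG₀` HAS a one-sided letter and the Neumann series is (K71)'s — NOTHING of print's proof is reproduced.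

WHAT IS PROVED (sorry-free; proof lane — 0 `def`; [folklore] letter algebra over DISPLAYED identities and letters).  Two weighted carriers — bonds
`(X_B, w_B, π_B)`, sites `(X_S, w_S, π_S)` — over one block lattice `(Y, δ)`; CLMs `G₀ : B → B`, `M D : S → B`, `M† D* : B → S` (`Mt`, `Ds`), `G′ R : S → S`
(`Gp`, `R`), and `K♭ Bb Gt : B → B` related to them ONLY through the displayed equation `hKf` and identities `hB : 𝔅f = f + K♭(𝔅f)`, `hG : G̃f = G₀(𝔅f)`.
* §1 (abstract `(Y, δ)`) **`letter_Kflat`** — (L)(G₀; B₀, κ), (L)(D*∘G₀; B₁, κ), (L)(G′R; B₂, κ), (L)(D∘G′R; B₃, κ), (L)(D∘R∘G′; B₄, κ), (L)(M; ε, κ), (L)(M†; ε′, κ),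
  `0 ≤ κ′ ≤ κ`, `Σ_u e^{−(κ−κ′)δ(w,u)} ≤ S` ⟹ **(L)(K♭; εB₁B₂S² + ε′B₄(B₀ + B₁B₃S)S², κ′)** (five `letter_comp`, one `letter_add`, every summand ONE factor `ε` or
  `ε′`); **`letter_dressing`** — `hB`, (L)(K♭; q, κ′), `0 ≤ κ″ < κ′`, `Σ_u e^{−(κ′−κ″)δ(w,u)} ≤ S′`, `qS′S′ < 1` ⟹ (L)(𝔅; 1∕(1 − qS′S′), κ″) ((K71) `letter_of_neumann'`
  at `(G₀, D, T) := (1, K♭, 𝔅)` — the identity has the letter (L)(1; 1, κ′), `δ(v,v) = 0`); **`letter_postcomp_transfer`** — for ANY `X : B → (X₂, w₂, π₂)` with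
  (L)(X∘G₀; B_X, κ′): (L)(X∘G̃; B_X + M_𝔅·q·S′·B_X·S′, κ″) ((K71) `letter_postcomp_resolvent`).
* §2 (the coarse torus `T_m`, `δ = d_m`, `1 ≤ m_i`) **`letter_right_transfer_torus`** — ALL OF §1 IN ONE STROKE: the displayed word `hKf`, `hB`, `hG`, the seven
  letters at rate `κ`, (L)(X∘G₀; B_X, κ′), `0 ≤ κ″ < κ′ < κ`, `q := εB₁B₂K² + ε′B₄(B₀ + B₁B₃K)K²`, `K = K_d(κ−κ′)`, `K′ = K_d(κ′−κ″)`, `qK′K′ < 1` ⟹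
  **(L)(X∘G̃; B_X + (1∕(1 − qK′K′))·q·K′·B_X·K′, κ″)**.  At `X = 1`, `X = D*_U`, `X =` the slice derivative: the value, divergence and gradient rows of print's
  `G̃` from those of `G₀` — THE INSTANTIATION at the tower (ne9-leaf-03 g80's `B9Eq3130HessianSlotDifferenceTower` (d′)(d″) = `hG`, `hB`; (K64), (DGK),
  (DRC)∘`R_k`, (K70), the mirror `D_U∘R_k∘G′_k`, (K75)'s stencil letters = the seven letters; (K64)∕(DGK)∕(E2) = `X∘G₀`) is the chain's next file.
HONEST SCOPE.  Letter algebra; constants crude (no optimisation of the `K`-powers); the identities and letters are the suppliers' and the instantiator's; nothing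
of [B9] (3.130)–(3.133), Thm 3.3∕3.13 asserted, valued or discharged; «NE9 ⇐ the named binders»; NE9 NOT PRINTED ∕ NOT PROVED; row WALLED ON A MODEL (O-NE9-1;
#5 UNRULED); spine PROVED 0∕9; rung (B)+1 on a finite T⁴ — NOT infinite volume, NOT mass gap, NOT BetaPertH, NOT Clay.  HONEST DEPENDENCY: continuum YM on T⁴ ⇐
BetaPertH ∧ nine spine estimates (0/9 proved); BetaPertH ⇐ (D1) ∧ (D4) ∧ CAP+tail; G-an2-4 gates asym, D1 and NE2/3/4.  NEW file importing (K71)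
`B9Eq3130NeumannLetter` only (BUILT); nothing modified.  Net new unproved facts: 0.
-/

noncomputable section

set_option autoImplicit false

open scoped BigOperators

namespace Literature.MathematicalPhysics.QuantumFieldTheory.Balaban1983to89.B9Eq3130RightNeumannTransfer

open B9Eq311L2Pairing (WL2)
open B4Sect5Torus (TSite tdist tdist_triangle tdist_nonneg tdist_self torusSum_le)
open B4Sect5Proof (latticeConst latticeConst_nonneg)
open B9Eq326G1SupRowOfLetters (letter_comp letter_mono letter_add)
open B9Eq3130NeumannLetter (letter_of_neumann' letter_postcomp_resolvent exists_apriori_letter)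

/-! ## §1 The right-grouped transfer on an abstract block lattice with two weighted carriers (bonds, sites) -/

section Abstract

variable {𝕜 : Type*} [RCLike 𝕜] {Y : Type*} [Fintype Y] (δ : Y → Y → ℝ)
  {XB : Type*} [Fintype XB] [Nonempty XB] {wB : XB → ℝ} [Fact (∀ x, 0 < wB x)]
  {XS : Type*} [Fintype XS] [Nonempty XS] {wS : XS → ℝ} [Fact (∀ x, 0 < wS x)]
  {VB : Type*} [NormedAddCommGroup VB] [InnerProductSpace 𝕜 VB] {VS : Type*} [NormedAddCommGroup VS] [InnerProductSpace 𝕜 VS]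
  (πB : XB → Y) (πS : XS → Y)
  (G₀ : WL2 𝕜 wB VB →L[𝕜] WL2 𝕜 wB VB) (M D : WL2 𝕜 wS VS →L[𝕜] WL2 𝕜 wB VB) (Mt Ds : WL2 𝕜 wB VB →L[𝕜] WL2 𝕜 wS VS)
  (Gp R : WL2 𝕜 wS VS →L[𝕜] WL2 𝕜 wS VS)

omit [Fintype Y] [Nonempty XB] in
/-- The letter of `−T` is the letter of `T`. [folklore] [cite: Balaban1985BackgroundPropagators, Thm 3.1 (3.42) p.397] -/
private theorem letter_neg {X₂ : Type*} [Fintype X₂] {w₂ : X₂ → ℝ} [Fact (∀ x, 0 < w₂ x)] {V₂ : Type*} [NormedAddCommGroup V₂]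
    [InnerProductSpace 𝕜 V₂] (π₂ : X₂ → Y) (T : WL2 𝕜 wB VB →L[𝕜] WL2 𝕜 w₂ V₂) {B κ : ℝ}
    (h : ∀ (v : Y) (f : WL2 𝕜 wB VB) (F : ℝ), (∀ x, πB x ≠ v → WL2.equiv 𝕜 wB VB f x = 0) → (∀ x, ‖WL2.equiv 𝕜 wB VB f x‖ ≤ F) →
      ∀ x, ‖WL2.equiv 𝕜 w₂ V₂ (T f) x‖ ≤ B * Real.exp (-(κ * δ (π₂ x) v)) * F)
    (v : Y) (f : WL2 𝕜 wB VB) (F : ℝ) (hfv : ∀ x, πB x ≠ v → WL2.equiv 𝕜 wB VB f x = 0) (hfF : ∀ x, ‖WL2.equiv 𝕜 wB VB f x‖ ≤ F)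
    (x : X₂) : ‖WL2.equiv 𝕜 w₂ V₂ ((-T) f) x‖ ≤ B * Real.exp (-(κ * δ (π₂ x) v)) * F := by
  have e : WL2.equiv 𝕜 w₂ V₂ ((-T) f) x = -(WL2.equiv 𝕜 w₂ V₂ (T f) x) := rfl
  rw [e, norm_neg]
  exact h v f F hfv hfF x

omit [Nonempty XS] in
/-- **THE LETTER OF `K♭ := −Δ′_π∘G₀ = M∘G′R∘D*G₀ + D R G′∘M†∘(G₀ − D G′R∘D*G₀)` FROM SEVEN LANDED LETTERS** — every summand carries ONE factor `ε` (the stencil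
`M = Δ∘D_U`) or `ε′` (its transpose `M† = D*_U∘Δ`): (L)(G₀; B₀, κ), (L)(D*∘G₀; B₁, κ), (L)(G′R; B₂, κ), (L)(D∘G′R; B₃, κ), (L)(D∘R∘G′; B₄, κ), (L)(M; ε, κ),
(L)(M†; ε′, κ), `0 ≤ κ′ ≤ κ`, `Σ_u e^{−(κ−κ′)δ(w,u)} ≤ S` ⟹ (L)(K♭; εB₁B₂S² + ε′B₄(B₀ + B₁B₃S)S², κ′).  The input-side `D*` of print's `P = G′RD*` lands on `G₀`
(the divergence row `B₁`), which is why the RIGHT grouping `Δ′_πG₀` of (3.130) is one-sided (t4-ne9-idea-1 N55). [folklore]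
[cite: Balaban1985BackgroundPropagators, (3.130) p.421, (3.120) p.419, Thm 3.1 (3.42) p.397] [cite: Balaban1984PropagatorsII, Lemma 2.1 (2.61) p.234] -/
theorem letter_Kflat (hδ0 : ∀ u v, 0 ≤ δ u v) (hδt : ∀ u y v, δ u v ≤ δ u y + δ y v)
    (Kf : WL2 𝕜 wB VB →L[𝕜] WL2 𝕜 wB VB)
    (hKf : Kf = M ∘L (Gp ∘L R) ∘L (Ds ∘L G₀) + (D ∘L R ∘L Gp) ∘L Mt ∘L (G₀ - (D ∘L Gp ∘L R) ∘L (Ds ∘L G₀)))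
    {B₀ B₁ B₂ B₃ B₄ ε ε' κ κ' S : ℝ} (hB₀ : 0 ≤ B₀) (hB₁ : 0 ≤ B₁) (hB₂ : 0 ≤ B₂) (hB₃ : 0 ≤ B₃) (hB₄ : 0 ≤ B₄) (hε : 0 ≤ ε) (hε' : 0 ≤ ε')
    (hκ' : 0 ≤ κ') (hκ : κ' ≤ κ)
    (hG₀ : ∀ (v : Y) (f : WL2 𝕜 wB VB) (F : ℝ), (∀ x, πB x ≠ v → WL2.equiv 𝕜 wB VB f x = 0) → (∀ x, ‖WL2.equiv 𝕜 wB VB f x‖ ≤ F) →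
      ∀ x, ‖WL2.equiv 𝕜 wB VB (G₀ f) x‖ ≤ B₀ * Real.exp (-(κ * δ (πB x) v)) * F)
    (hDsG₀ : ∀ (v : Y) (f : WL2 𝕜 wB VB) (F : ℝ), (∀ x, πB x ≠ v → WL2.equiv 𝕜 wB VB f x = 0) → (∀ x, ‖WL2.equiv 𝕜 wB VB f x‖ ≤ F) →
      ∀ x, ‖WL2.equiv 𝕜 wS VS ((Ds ∘L G₀) f) x‖ ≤ B₁ * Real.exp (-(κ * δ (πS x) v)) * F)
    (hGpR : ∀ (v : Y) (f : WL2 𝕜 wS VS) (F : ℝ), (∀ x, πS x ≠ v → WL2.equiv 𝕜 wS VS f x = 0) → (∀ x, ‖WL2.equiv 𝕜 wS VS f x‖ ≤ F) →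
      ∀ x, ‖WL2.equiv 𝕜 wS VS ((Gp ∘L R) f) x‖ ≤ B₂ * Real.exp (-(κ * δ (πS x) v)) * F)
    (hDGpR : ∀ (v : Y) (f : WL2 𝕜 wS VS) (F : ℝ), (∀ x, πS x ≠ v → WL2.equiv 𝕜 wS VS f x = 0) → (∀ x, ‖WL2.equiv 𝕜 wS VS f x‖ ≤ F) →
      ∀ x, ‖WL2.equiv 𝕜 wB VB ((D ∘L Gp ∘L R) f) x‖ ≤ B₃ * Real.exp (-(κ * δ (πB x) v)) * F)
    (hDRGp : ∀ (v : Y) (f : WL2 𝕜 wS VS) (F : ℝ), (∀ x, πS x ≠ v → WL2.equiv 𝕜 wS VS f x = 0) → (∀ x, ‖WL2.equiv 𝕜 wS VS f x‖ ≤ F) →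
      ∀ x, ‖WL2.equiv 𝕜 wB VB ((D ∘L R ∘L Gp) f) x‖ ≤ B₄ * Real.exp (-(κ * δ (πB x) v)) * F)
    (hM : ∀ (v : Y) (f : WL2 𝕜 wS VS) (F : ℝ), (∀ x, πS x ≠ v → WL2.equiv 𝕜 wS VS f x = 0) → (∀ x, ‖WL2.equiv 𝕜 wS VS f x‖ ≤ F) →
      ∀ x, ‖WL2.equiv 𝕜 wB VB (M f) x‖ ≤ ε * Real.exp (-(κ * δ (πB x) v)) * F)
    (hMt : ∀ (v : Y) (f : WL2 𝕜 wB VB) (F : ℝ), (∀ x, πB x ≠ v → WL2.equiv 𝕜 wB VB f x = 0) → (∀ x, ‖WL2.equiv 𝕜 wB VB f x‖ ≤ F) →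
      ∀ x, ‖WL2.equiv 𝕜 wS VS (Mt f) x‖ ≤ ε' * Real.exp (-(κ * δ (πS x) v)) * F)
    (hS : ∀ w', ∑ u, Real.exp (-((κ - κ') * δ w' u)) ≤ S)
    (v : Y) (f : WL2 𝕜 wB VB) (F : ℝ) (hfv : ∀ x, πB x ≠ v → WL2.equiv 𝕜 wB VB f x = 0) (hfF : ∀ x, ‖WL2.equiv 𝕜 wB VB f x‖ ≤ F) (x : XB) :
    ‖WL2.equiv 𝕜 wB VB (Kf f) x‖ ≤ (ε * B₁ * B₂ * S ^ 2 + ε' * B₄ * (B₀ + B₁ * B₃ * S) * S ^ 2) * Real.exp (-(κ' * δ (πB x) v)) * F := by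
  have hSnn : 0 ≤ S := (Finset.sum_nonneg fun u _ => Real.exp_nonneg _).trans (hS v)
  -- term A: `M ∘ (G′R) ∘ (D*G₀)` at the target rate
  have hA₁ := letter_comp δ πB πS πS (Ds ∘L G₀) (Gp ∘L R) hδ0 hδt hB₁ hB₂ hκ' hκ hDsG₀ hGpR hS
  have hA := letter_comp δ πB πS πB ((Gp ∘L R) ∘L (Ds ∘L G₀)) M hδ0 hδt (by positivity : (0 : ℝ) ≤ B₁ * B₂ * S) hε hκ' le_rfl hA₁ hM hS
  -- term B: `(D R G′) ∘ M† ∘ W`, `W = G₀ − (D G′R) ∘ (D*G₀)`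
  have hW₂ := letter_comp δ πB πS πB (Ds ∘L G₀) (D ∘L Gp ∘L R) hδ0 hδt hB₁ hB₃ hκ' hκ hDsG₀ hDGpR hS
  have hW₀ : ∀ (v : Y) (f : WL2 𝕜 wB VB) (F : ℝ), (∀ x, πB x ≠ v → WL2.equiv 𝕜 wB VB f x = 0) → (∀ x, ‖WL2.equiv 𝕜 wB VB f x‖ ≤ F) →
      ∀ x, ‖WL2.equiv 𝕜 wB VB (G₀ f) x‖ ≤ B₀ * Real.exp (-(κ' * δ (πB x) v)) * F :=
    fun v f F hfv hfF x => letter_mono δ πB πB G₀ hδ0 hB₀ le_rfl hκ hG₀ v f F hfv hfF x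
  have hW := letter_add δ πB πB G₀ (-((D ∘L Gp ∘L R) ∘L (Ds ∘L G₀))) hW₀ (letter_neg δ πB πB _ hW₂)
  have hW' : ∀ (v : Y) (f : WL2 𝕜 wB VB) (F : ℝ), (∀ x, πB x ≠ v → WL2.equiv 𝕜 wB VB f x = 0) → (∀ x, ‖WL2.equiv 𝕜 wB VB f x‖ ≤ F) →
      ∀ x, ‖WL2.equiv 𝕜 wB VB ((G₀ - (D ∘L Gp ∘L R) ∘L (Ds ∘L G₀)) f) x‖ ≤ (B₀ + B₁ * B₃ * S) * Real.exp (-(κ' * δ (πB x) v)) * F := by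
    intro v f F hfv hfF x
    have e : (G₀ - (D ∘L Gp ∘L R) ∘L (Ds ∘L G₀)) = G₀ + -((D ∘L Gp ∘L R) ∘L (Ds ∘L G₀)) := sub_eq_add_neg _ _
    rw [e]
    exact hW v f F hfv hfF x
  have hMtW := letter_comp δ πB πB πS (G₀ - (D ∘L Gp ∘L R) ∘L (Ds ∘L G₀)) Mt hδ0 hδt (by positivity : (0 : ℝ) ≤ B₀ + B₁ * B₃ * S) hε' hκ'
    le_rfl hW' hMt hS
  have hB := letter_comp δ πB πS πB (Mt ∘L (G₀ - (D ∘L Gp ∘L R) ∘L (Ds ∘L G₀))) (D ∘L R ∘L Gp) hδ0 hδt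
    (by positivity : (0 : ℝ) ≤ (B₀ + B₁ * B₃ * S) * ε' * S) hB₄ hκ' le_rfl hMtW hDRGp hS
  have hsum := letter_add δ πB πB (M ∘L ((Gp ∘L R) ∘L (Ds ∘L G₀))) ((D ∘L R ∘L Gp) ∘L (Mt ∘L (G₀ - (D ∘L Gp ∘L R) ∘L (Ds ∘L G₀))))
    hA hB v f F hfv hfF x
  have e : Kf = M ∘L ((Gp ∘L R) ∘L (Ds ∘L G₀)) + (D ∘L R ∘L Gp) ∘L (Mt ∘L (G₀ - (D ∘L Gp ∘L R) ∘L (Ds ∘L G₀))) := by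
    rw [hKf]
  rw [e]
  exact hsum.trans (le_of_eq (by ring))

/-- **THE DRESSING OPERATOR `𝔅 = (1 + Δ′_πG₀)⁻¹` HAS A LETTER** — from the identity `𝔅 = 1 + K♭∘𝔅` (displayed: `hB`), the letter (L)(K♭; q, κ′) of
`letter_Kflat` (or any), `0 ≤ κ″ < κ′`, the row constant `Σ_u e^{−(κ′−κ″)δ(w,u)} ≤ S′` and the contraction `q·S′·S′ < 1`: (L)(𝔅; 1∕(1 − qS′S′), κ″) — (K71)
`letter_of_neumann'` at `(G₀, D, T) := (1, K♭, 𝔅)` (the identity has the letter (L)(1; 1, κ′) for free; NO a-priori letter asked). [folklore]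
[cite: Balaban1985BackgroundPropagators, (3.130) p.421 «G = G₀(I − Δ′_πG₀)⁻¹»] [cite: Balaban1984PropagatorsII, Lemma 2.1 (2.61) p.234] -/
theorem letter_dressing (hδ0 : ∀ u v, 0 ≤ δ u v) (hδt : ∀ u y v, δ u v ≤ δ u y + δ y v) (hδs : ∀ v, δ v v = 0)
    (Kf Bb : WL2 𝕜 wB VB →L[𝕜] WL2 𝕜 wB VB) (hB : ∀ f, Bb f = f + Kf (Bb f))
    {q κ' κ'' S' : ℝ} (hq0 : 0 ≤ q) (hκ'' : 0 ≤ κ'') (hκ' : κ'' < κ')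
    (hKf : ∀ (v : Y) (f : WL2 𝕜 wB VB) (F : ℝ), (∀ x, πB x ≠ v → WL2.equiv 𝕜 wB VB f x = 0) → (∀ x, ‖WL2.equiv 𝕜 wB VB f x‖ ≤ F) →
      ∀ x, ‖WL2.equiv 𝕜 wB VB (Kf f) x‖ ≤ q * Real.exp (-(κ' * δ (πB x) v)) * F)
    (hS' : ∀ w', ∑ u, Real.exp (-((κ' - κ'') * δ w' u)) ≤ S') (hq : q * S' * 1 * S' < 1)
    (v : Y) (f : WL2 𝕜 wB VB) (F : ℝ) (hfv : ∀ x, πB x ≠ v → WL2.equiv 𝕜 wB VB f x = 0) (hfF : ∀ x, ‖WL2.equiv 𝕜 wB VB f x‖ ≤ F) (x : XB) :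
    ‖WL2.equiv 𝕜 wB VB (Bb f) x‖ ≤ 1 / (1 - q * S' * 1 * S') * Real.exp (-(κ'' * δ (πB x) v)) * F := by
  -- the identity operator has the letter (L)(1; 1, κ′)
  have hId : ∀ (v : Y) (f : WL2 𝕜 wB VB) (F : ℝ), (∀ x, πB x ≠ v → WL2.equiv 𝕜 wB VB f x = 0) → (∀ x, ‖WL2.equiv 𝕜 wB VB f x‖ ≤ F) →
      ∀ x, ‖WL2.equiv 𝕜 wB VB ((ContinuousLinearMap.id 𝕜 (WL2 𝕜 wB VB)) f) x‖ ≤ 1 * Real.exp (-(κ' * δ (πB x) v)) * F := by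
    intro v f F hfv hfF x
    rw [ContinuousLinearMap.id_apply]
    by_cases hx : πB x = v
    · rw [hx, hδs, mul_zero, neg_zero, Real.exp_zero, one_mul, one_mul]; exact hfF x
    · rw [hfv x hx, norm_zero]
      obtain ⟨x₀⟩ := ‹Nonempty XB›
      have hF : 0 ≤ F := (norm_nonneg _).trans (hfF x₀)
      positivity
  have hT : ∀ f, Bb f = (ContinuousLinearMap.id 𝕜 (WL2 𝕜 wB VB)) f + (ContinuousLinearMap.id 𝕜 (WL2 𝕜 wB VB)) (Kf (Bb f)) := fun f => by
    rw [ContinuousLinearMap.id_apply, ContinuousLinearMap.id_apply]; exact hB f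
  exact letter_of_neumann' δ πB (ContinuousLinearMap.id 𝕜 (WL2 𝕜 wB VB)) Kf Bb hδ0 hδt hT zero_le_one hq0 hκ'' hκ' hId hKf hS' hq v f F hfv hfF x

omit [Nonempty XS] in
/-- **EVERY ROW OF `G₀` TRANSFERS TO `G̃ = G₀∘𝔅` BY ONE COMPOSITION** (the right grouping of (3.130), t4-ne9-idea-1 N55): for ANY continuous linear `X` from the
bonds to any weighted carrier with a letter (L)(X∘G₀; B_X, κ′) (the value row `X = 1`: (K64); the divergence row `X = D*_U`: (DGK); the slice-gradient row: (E2); …), the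
identities `G̃ = G₀∘𝔅` (`hG`) and `𝔅 = 1 + K♭∘𝔅` (`hB`), the letters (L)(K♭; q, κ′) and (L)(𝔅; M_𝔅, κ″) (`letter_dressing`), `Σ_u e^{−(κ′−κ″)δ(w,u)} ≤ S′` ⟹
(L)(X∘G̃; B_X + M_𝔅·q·S′·B_X·S′, κ″) — (K71) `letter_postcomp_resolvent`. [folklore] [cite: Balaban1985BackgroundPropagators, (3.130) p.421, Thm 3.13 p.426, Thm 3.1 (3.42) p.397]
[cite: Balaban1984PropagatorsII, Lemma 2.1 (2.61) p.234] -/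
theorem letter_postcomp_transfer {X₂ : Type*} [Fintype X₂] {w₂ : X₂ → ℝ} [Fact (∀ x, 0 < w₂ x)] {V₂ : Type*} [NormedAddCommGroup V₂]
    [InnerProductSpace 𝕜 V₂] (π₂ : X₂ → Y) (X : WL2 𝕜 wB VB →L[𝕜] WL2 𝕜 w₂ V₂)
    (hδ0 : ∀ u v, 0 ≤ δ u v) (hδt : ∀ u y v, δ u v ≤ δ u y + δ y v)
    (Kf Bb Gt : WL2 𝕜 wB VB →L[𝕜] WL2 𝕜 wB VB) (hB : ∀ f, Bb f = f + Kf (Bb f)) (hG : ∀ f, Gt f = G₀ (Bb f))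
    {BX q MB κ' κ'' S' : ℝ} (hBX : 0 ≤ BX) (hq0 : 0 ≤ q) (hMB : 0 ≤ MB) (hκ'' : 0 ≤ κ'') (hκ' : κ'' < κ')
    (hXG₀ : ∀ (v : Y) (f : WL2 𝕜 wB VB) (F : ℝ), (∀ x, πB x ≠ v → WL2.equiv 𝕜 wB VB f x = 0) → (∀ x, ‖WL2.equiv 𝕜 wB VB f x‖ ≤ F) →
      ∀ x, ‖WL2.equiv 𝕜 w₂ V₂ ((X ∘L G₀) f) x‖ ≤ BX * Real.exp (-(κ' * δ (π₂ x) v)) * F)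
    (hKf : ∀ (v : Y) (f : WL2 𝕜 wB VB) (F : ℝ), (∀ x, πB x ≠ v → WL2.equiv 𝕜 wB VB f x = 0) → (∀ x, ‖WL2.equiv 𝕜 wB VB f x‖ ≤ F) →
      ∀ x, ‖WL2.equiv 𝕜 wB VB (Kf f) x‖ ≤ q * Real.exp (-(κ' * δ (πB x) v)) * F)
    (hBb : ∀ (v : Y) (f : WL2 𝕜 wB VB) (F : ℝ), (∀ x, πB x ≠ v → WL2.equiv 𝕜 wB VB f x = 0) → (∀ x, ‖WL2.equiv 𝕜 wB VB f x‖ ≤ F) →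
      ∀ x, ‖WL2.equiv 𝕜 wB VB (Bb f) x‖ ≤ MB * Real.exp (-(κ'' * δ (πB x) v)) * F)
    (hS' : ∀ w', ∑ u, Real.exp (-((κ' - κ'') * δ w' u)) ≤ S')
    (v : Y) (f : WL2 𝕜 wB VB) (F : ℝ) (hfv : ∀ x, πB x ≠ v → WL2.equiv 𝕜 wB VB f x = 0) (hfF : ∀ x, ‖WL2.equiv 𝕜 wB VB f x‖ ≤ F) (x : X₂) :
    ‖WL2.equiv 𝕜 w₂ V₂ ((X ∘L Gt) f) x‖ ≤ (BX + MB * q * S' * BX * S') * Real.exp (-(κ'' * δ (π₂ x) v)) * F := by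
  have hPT : ∀ f, (X ∘L Gt) f = (X ∘L G₀) f + (X ∘L G₀) (Kf (Bb f)) := fun f => by
    simp only [ContinuousLinearMap.coe_comp, Function.comp_apply]
    rw [hG f, hB f, map_add, map_add, ← hB f]
  exact letter_postcomp_resolvent δ πB Kf Bb π₂ (X ∘L G₀) (X ∘L Gt) hδ0 hδt hPT hBX hq0 hMB hκ'' hκ' hXG₀ hKf hBb hS' v f F hfv hfF x

end Abstract

/-! ## §2 Over the coarse torus `T_m`: the whole transfer in one stroke, row constants discharged (volume-free) -/

section Lattice

variable {𝕜 : Type*} [RCLike 𝕜] {d : ℕ} {m : Fin d → ℕ}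
  {XB : Type*} [Fintype XB] [Nonempty XB] {wB : XB → ℝ} [Fact (∀ x, 0 < wB x)]
  {XS : Type*} [Fintype XS] {wS : XS → ℝ} [Fact (∀ x, 0 < wS x)]
  {VB : Type*} [NormedAddCommGroup VB] [InnerProductSpace 𝕜 VB] {VS : Type*} [NormedAddCommGroup VS] [InnerProductSpace 𝕜 VS]
  (πB : XB → TSite d m) (πS : XS → TSite d m)
  (G₀ : WL2 𝕜 wB VB →L[𝕜] WL2 𝕜 wB VB) (M D : WL2 𝕜 wS VS →L[𝕜] WL2 𝕜 wB VB) (Mt Ds : WL2 𝕜 wB VB →L[𝕜] WL2 𝕜 wS VS)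
  (Gp R : WL2 𝕜 wS VS →L[𝕜] WL2 𝕜 wS VS)

/-- **THE RIGHT-GROUPED (3.130) TRANSFER OVER THE COARSE TORUS, IN ONE STROKE** (`δ = d_m`, `1 ≤ m_i`, `K = K_d(κ−κ′)`, `K′ = K_d(κ′−κ″)` by `torusSum_le`): from
the two identities `𝔅 = 1 + K♭∘𝔅` (`hB`, with `K♭` the displayed word `hKf` in `G₀, G′R, D, D*, M, M†`) and `G̃ = G₀∘𝔅` (`hG`), the SEVEN letters at rate `κ` and
ANY post-composition `X` with a letter (L)(X∘G₀; B_X, κ′): if `q·K′·K′ < 1` for `q := εB₁B₂K² + ε′B₄(B₀ + B₁B₃K)K²` then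
**(L)(X∘G̃; B_X + (1∕(1 − qK′K′))·q·K′·B_X·K′, κ″)** — closed form, no hidden existential. At `X = 1`, `X = D*_U`, `X =` the slice derivative this is the value,
divergence and gradient row of print's `G̃` from those of `G₀`. [folklore] [cite: Balaban1985BackgroundPropagators, (3.130) p.421, Thm 3.13 p.426, Thm 3.1
(3.42)–(3.47) pp.397–398] [cite: Balaban1984PropagatorsII, Lemma 2.1 (2.61) p.234] -/
theorem letter_right_transfer_torus {X₂ : Type*} [Fintype X₂] {w₂ : X₂ → ℝ} [Fact (∀ x, 0 < w₂ x)] {V₂ : Type*} [NormedAddCommGroup V₂]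
    [InnerProductSpace 𝕜 V₂] (π₂ : X₂ → TSite d m) (X : WL2 𝕜 wB VB →L[𝕜] WL2 𝕜 w₂ V₂) (hm : ∀ i, 1 ≤ m i)
    (Kf Bb Gt : WL2 𝕜 wB VB →L[𝕜] WL2 𝕜 wB VB)
    (hKf : Kf = M ∘L (Gp ∘L R) ∘L (Ds ∘L G₀) + (D ∘L R ∘L Gp) ∘L Mt ∘L (G₀ - (D ∘L Gp ∘L R) ∘L (Ds ∘L G₀)))
    (hB : ∀ f, Bb f = f + Kf (Bb f)) (hG : ∀ f, Gt f = G₀ (Bb f))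
    {B₀ B₁ B₂ B₃ B₄ ε ε' BX κ κ' κ'' : ℝ} (hB₀ : 0 ≤ B₀) (hB₁ : 0 ≤ B₁) (hB₂ : 0 ≤ B₂) (hB₃ : 0 ≤ B₃) (hB₄ : 0 ≤ B₄) (hε : 0 ≤ ε)
    (hε' : 0 ≤ ε') (hBX : 0 ≤ BX) (hκ'' : 0 ≤ κ'') (hκ' : κ'' < κ') (hκ : κ' < κ)
    (hG₀ : ∀ (v : TSite d m) (f : WL2 𝕜 wB VB) (F : ℝ), (∀ x, πB x ≠ v → WL2.equiv 𝕜 wB VB f x = 0) → (∀ x, ‖WL2.equiv 𝕜 wB VB f x‖ ≤ F) →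
      ∀ x, ‖WL2.equiv 𝕜 wB VB (G₀ f) x‖ ≤ B₀ * Real.exp (-(κ * tdist m (πB x) v)) * F)
    (hDsG₀ : ∀ (v : TSite d m) (f : WL2 𝕜 wB VB) (F : ℝ), (∀ x, πB x ≠ v → WL2.equiv 𝕜 wB VB f x = 0) → (∀ x, ‖WL2.equiv 𝕜 wB VB f x‖ ≤ F) →
      ∀ x, ‖WL2.equiv 𝕜 wS VS ((Ds ∘L G₀) f) x‖ ≤ B₁ * Real.exp (-(κ * tdist m (πS x) v)) * F)
    (hGpR : ∀ (v : TSite d m) (f : WL2 𝕜 wS VS) (F : ℝ), (∀ x, πS x ≠ v → WL2.equiv 𝕜 wS VS f x = 0) → (∀ x, ‖WL2.equiv 𝕜 wS VS f x‖ ≤ F) →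
      ∀ x, ‖WL2.equiv 𝕜 wS VS ((Gp ∘L R) f) x‖ ≤ B₂ * Real.exp (-(κ * tdist m (πS x) v)) * F)
    (hDGpR : ∀ (v : TSite d m) (f : WL2 𝕜 wS VS) (F : ℝ), (∀ x, πS x ≠ v → WL2.equiv 𝕜 wS VS f x = 0) → (∀ x, ‖WL2.equiv 𝕜 wS VS f x‖ ≤ F) →
      ∀ x, ‖WL2.equiv 𝕜 wB VB ((D ∘L Gp ∘L R) f) x‖ ≤ B₃ * Real.exp (-(κ * tdist m (πB x) v)) * F)
    (hDRGp : ∀ (v : TSite d m) (f : WL2 𝕜 wS VS) (F : ℝ), (∀ x, πS x ≠ v → WL2.equiv 𝕜 wS VS f x = 0) → (∀ x, ‖WL2.equiv 𝕜 wS VS f x‖ ≤ F) →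
      ∀ x, ‖WL2.equiv 𝕜 wB VB ((D ∘L R ∘L Gp) f) x‖ ≤ B₄ * Real.exp (-(κ * tdist m (πB x) v)) * F)
    (hM : ∀ (v : TSite d m) (f : WL2 𝕜 wS VS) (F : ℝ), (∀ x, πS x ≠ v → WL2.equiv 𝕜 wS VS f x = 0) → (∀ x, ‖WL2.equiv 𝕜 wS VS f x‖ ≤ F) →
      ∀ x, ‖WL2.equiv 𝕜 wB VB (M f) x‖ ≤ ε * Real.exp (-(κ * tdist m (πB x) v)) * F)
    (hMt : ∀ (v : TSite d m) (f : WL2 𝕜 wB VB) (F : ℝ), (∀ x, πB x ≠ v → WL2.equiv 𝕜 wB VB f x = 0) → (∀ x, ‖WL2.equiv 𝕜 wB VB f x‖ ≤ F) →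
      ∀ x, ‖WL2.equiv 𝕜 wS VS (Mt f) x‖ ≤ ε' * Real.exp (-(κ * tdist m (πS x) v)) * F)
    (hXG₀ : ∀ (v : TSite d m) (f : WL2 𝕜 wB VB) (F : ℝ), (∀ x, πB x ≠ v → WL2.equiv 𝕜 wB VB f x = 0) → (∀ x, ‖WL2.equiv 𝕜 wB VB f x‖ ≤ F) →
      ∀ x, ‖WL2.equiv 𝕜 w₂ V₂ ((X ∘L G₀) f) x‖ ≤ BX * Real.exp (-(κ' * tdist m (π₂ x) v)) * F)
    (hq : (ε * B₁ * B₂ * latticeConst d (κ - κ') ^ 2 + ε' * B₄ * (B₀ + B₁ * B₃ * latticeConst d (κ - κ')) * latticeConst d (κ - κ') ^ 2) *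
      latticeConst d (κ' - κ'') * 1 * latticeConst d (κ' - κ'') < 1)
    (v : TSite d m) (f : WL2 𝕜 wB VB) (F : ℝ) (hfv : ∀ x, πB x ≠ v → WL2.equiv 𝕜 wB VB f x = 0) (hfF : ∀ x, ‖WL2.equiv 𝕜 wB VB f x‖ ≤ F) (x : X₂) :
    ‖WL2.equiv 𝕜 w₂ V₂ ((X ∘L Gt) f) x‖ ≤
      (BX + 1 / (1 - (ε * B₁ * B₂ * latticeConst d (κ - κ') ^ 2 + ε' * B₄ * (B₀ + B₁ * B₃ * latticeConst d (κ - κ')) * latticeConst d (κ - κ') ^ 2) *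
          latticeConst d (κ' - κ'') * 1 * latticeConst d (κ' - κ'')) *
        (ε * B₁ * B₂ * latticeConst d (κ - κ') ^ 2 + ε' * B₄ * (B₀ + B₁ * B₃ * latticeConst d (κ - κ')) * latticeConst d (κ - κ') ^ 2) *
        latticeConst d (κ' - κ'') * BX * latticeConst d (κ' - κ'')) * Real.exp (-(κ'' * tdist m (π₂ x) v)) * F := by
  set K := latticeConst d (κ - κ') with hK
  set K' := latticeConst d (κ' - κ'') with hK'
  set q := ε * B₁ * B₂ * K ^ 2 + ε' * B₄ * (B₀ + B₁ * B₃ * K) * K ^ 2 with hqdef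
  have hKnn : 0 ≤ K := latticeConst_nonneg d (sub_nonneg.2 hκ.le)
  have hK'nn : 0 ≤ K' := latticeConst_nonneg d (sub_nonneg.2 hκ'.le)
  have hq0 : 0 ≤ q := by positivity
  have hδ0 := tdist_nonneg m
  have hδt : ∀ u y w', tdist m u w' ≤ tdist m u y + tdist m y w' := fun u y w' => tdist_triangle hm u y w'
  have hS : ∀ w', ∑ u, Real.exp (-((κ - κ') * tdist m w' u)) ≤ K := fun w' => torusSum_le d hm (sub_pos.2 hκ) w'
  have hS' : ∀ w', ∑ u, Real.exp (-((κ' - κ'') * tdist m w' u)) ≤ K' := fun w' => torusSum_le d hm (sub_pos.2 hκ') w'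
  -- (L)(K♭; q, κ′)
  have hKfL := letter_Kflat (tdist m) πB πS G₀ M D Mt Ds Gp R hδ0 hδt Kf hKf hB₀ hB₁ hB₂ hB₃ hB₄ hε hε' (hκ''.trans hκ'.le) hκ.le hG₀ hDsG₀ hGpR hDGpR hDRGp
    hM hMt hS
  -- (L)(𝔅; 1∕(1 − qK′K′), κ″)
  have hMB : 0 ≤ 1 / (1 - q * K' * 1 * K') := by
    have : q * K' * 1 * K' < 1 := hq
    exact div_nonneg zero_le_one (by linarith)
  have hBbL := letter_dressing (tdist m) πB hδ0 hδt (fun v => tdist_self m v) Kf Bb hB hq0 hκ'' hκ' hKfL hS' hq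
  exact letter_postcomp_transfer (tdist m) πB G₀ π₂ X hδ0 hδt Kf Bb Gt hB hG hBX hq0 hMB hκ'' hκ' hXG₀ hKfL hBbL hS' v f F hfv hfF x

end Lattice

end Literature.MathematicalPhysics.QuantumFieldTheory.Balaban1983to89.B9Eq3130RightNeumannTransfer
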